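import Summits.Ventures.DiscreteObjects.PP12.FlagOrbitCols
import Summits.Ventures.DiscreteObjects.PP12.FlagOrbitRows

/-!
# The generic flag-cell orbit matrix of a plane: definition, incidence symmetry, row and column totals, structural entries (kernel; Step C of the generic FlagOrbitReduction)
Framing: lottery ticket; floor = certified bounds/negative ranges.

Cell pub-namedobj (venture DiscreteObjects), target (M), designs gen 15. Setting as in `FlagOrbitIndexSets` (order 12, flag type, `σ³ = 1`,
`f = 13 − 3ρ`). **The matrix:** `flagMatR r c = |colOrbitR c ∩ lineRepR r|` — the number of points of the column orbit on the representative line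
of the row orbit (`FlagOrbitCols.colOrbitR`, `FlagOrbitRows.lineRepR`). This file proves:
* `flagMatR_eq_card_lines` — incidence symmetry: the same number counts the lines of the row orbit through the representative point of the
  column (`OrbitCountOrderThree.orb3_incidence_symm`);
* `sum_orbits3_card_filter` / `sum_lineOrbits3_card_filter` — at plane level, summing `|S ∩ a|` over the non-trivial point orbits counts the
  non-fixed points of `a` (dually for lines through a point); hence conjuncts 1–2 of `IsFlagOrbitMatrix`: `flagMatR_rowSum` (row totals
  `12 / 13 / 12` = `13 −` fixed points on a c-line / side / T-line) and `flagMatR_colSum` (column totals, dually);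
* conjunct 5 `flagMatR_gamma` (the c-line rows, `FlagOrbitCols.card_colOrbitR_filter_repF`), conjunct 6 `flagMatR_tline_z` (a T-line meets `l`
  in its fixed point `y_k`, which lies in no `Z`-orbit) and conjunct 7 `flagMatR_side_diag` (a side meets its own triangle in exactly the two
  vertices `x, σx`, `OrbitSideIdentities.filter_orb3_eq_pair_of_side`).
The quadratic conjuncts 3–4 and the assembly are `FlagOrbitReduction.lean`. No `sorry`, no new axioms.
-/

namespace Summit.Ventures.DiscreteObjects.PP12

open Configuration Finset
open scoped Classical

namespace Collineation

variable {P L : Type*} [Membership P L] [ProjectivePlane P L] [Fintype P] [Fintype L] (σ : Collineation P L)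

/-! ### Plane-level linear identities -/

omit [ProjectivePlane P L] [Fintype L] in
/-- **Summing the orbit-matrix entries of a line over the non-trivial point orbits counts its non-fixed points** (`σ³ = 1`). -/
theorem sum_orbits3_card_filter (hq : σ.onPoints ^ 3 = 1) (a : L) :
    ∑ S ∈ σ.orbits3, (S.filter fun q => q ∈ a).card = (univ.filter fun q : P => q ∈ a ∧ σ.onPoints q ≠ q).card := by
  set A := univ.filter fun q : P => q ∈ a ∧ σ.onPoints q ≠ q with hA
  have himg : ∀ q ∈ A, orb3 σ.onPoints q ∈ σ.orbits3 := by
    intro q hq'; rw [hA, mem_filter] at hq'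
    exact mem_image.2 ⟨q, mem_filter.2 ⟨mem_univ _, hq'.2.2⟩, rfl⟩
  rw [Finset.card_eq_sum_card_fiberwise himg]
  refine Finset.sum_congr rfl fun S hS => ?_
  obtain ⟨p, hp, rfl⟩ := mem_image.1 hS
  rw [mem_filter] at hp
  congr 1
  ext q
  simp only [hA, mem_filter, mem_univ, true_and]
  constructor
  · rintro ⟨hqp, hqa⟩
    exact ⟨⟨hqa, σ.not_fixed_of_mem_orb3 hp.2 hqp⟩, orb3_eq_of_mem _ hq hqp⟩
  · rintro ⟨⟨hqa, -⟩, he⟩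
    exact ⟨by rw [← he]; exact self_mem_orb3 _ _, hqa⟩

/-- Dually: **summing over the non-trivial line orbits the number of lines through `p` counts the non-fixed lines through `p`.** -/
theorem sum_lineOrbits3_card_filter (hq : σ.onPoints ^ 3 = 1) (p : P) :
    ∑ B ∈ σ.lineOrbits3, (B.filter fun m => p ∈ m).card = (univ.filter fun m : L => p ∈ m ∧ σ.onLines m ≠ m).card := by
  have hqL : σ.onLines ^ 3 = 1 := σ.onLines_pow_eq_one hq
  exact σ.dual.sum_orbits3_card_filter (a := (p : Dual P)) hqL

/-- The points of a line split into fixed and non-fixed ones: `#non-fixed + #fixed = n + 1`. -/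
theorem card_points_on_line_split (a : L) :
    (univ.filter fun q : P => q ∈ a ∧ σ.onPoints q ≠ q).card + (univ.filter fun q : P => q ∈ a ∧ σ.onPoints q = q).card
      = ProjectivePlane.order P L + 1 := by
  rw [← card_points_on_line (P := P) a]
  have h := Finset.card_filter_add_card_filter_not (s := univ.filter fun q : P => q ∈ a) (fun q => ¬ σ.onPoints q = q)
  rw [Finset.filter_filter, Finset.filter_filter] at h
  simp only [not_not] at h
  exact h

/-- Dually: `#(non-fixed lines through p) + #(fixed lines through p) = n + 1`. -/
theorem card_lines_through_split (p : P) :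
    (univ.filter fun m : L => p ∈ m ∧ σ.onLines m ≠ m).card + (univ.filter fun m : L => p ∈ m ∧ σ.onLines m = m).card
      = ProjectivePlane.order P L + 1 := by
  have h := σ.dual.card_points_on_line_split (a := (p : Dual P))
  rw [ProjectivePlane.Dual.order] at h
  exact h

section Flag

variable {l : L} {c : P}

section Data

variable (hl : σ.onLines l = l) (hc : σ.onPoints c = c) (hcl : c ∈ l)
  (hP : ∀ p : P, σ.onPoints p = p → p ∈ l) (hL : ∀ m : L, σ.onLines m = m → c ∈ m) (h12 : ProjectivePlane.order P L = 12)
  (hq : σ.onPoints ^ 3 = 1) {ρ : ℕ} (hf : fixedCard σ.onPoints = 13 - 3 * ρ)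

/-- **The orbit matrix of the plane** (generic flag cell): `flagMatR r c = |colOrbitR c ∩ lineRepR r|`. -/
noncomputable def flagMatR (r : FRow ρ) (c₀ : FCol ρ) : ℕ :=
  ((σ.colOrbitR hl hc hcl hP hL h12 hq hf c₀).filter fun q => q ∈ σ.lineRepR hl hc hcl hP hL h12 hq hf r).card

/-- **Incidence symmetry:** `flagMatR r c = #{m ∈ rowOrbitR r : pointRepR c ∈ m}`. -/
theorem flagMatR_eq_card_lines (r : FRow ρ) (c₀ : FCol ρ) :
    σ.flagMatR hl hc hcl hP hL h12 hq hf r c₀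
      = ((σ.rowOrbitR hl hc hcl hP hL h12 hq hf r).filter fun m => σ.pointRepR hl hc hcl hP hL h12 hq hf c₀ ∈ m).card := by
  have hqL : σ.onLines ^ 3 = 1 := σ.onLines_pow_eq_one hq
  unfold flagMatR
  rw [σ.rowOrbitR_eq_orb3_lineRepR hl hc hcl hP hL h12 hq hf r]
  obtain ⟨hco, hpf⟩ := σ.colOrbitR_eq_orb3_pointRepR hl hc hcl hP hL h12 hq hf c₀
  rw [hco]
  have hna := σ.lineRepR_not_fixed hl hc hcl hP hL h12 hq hf r
  have hs := σ.orb3_incidence_symm hq (σ.pointRepR hl hc hcl hP hL h12 hq hf c₀) (σ.lineRepR hl hc hcl hP hL h12 hq hf r)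
  rw [card_orb3_of_ne _ hq hpf, card_orb3_of_ne _ hqL hna] at hs
  exact (Nat.eq_of_mul_eq_mul_right (by norm_num) hs).symm

/-- **Conjunct 1 — row totals:** `Σ_c flagMatR r c = 13 − #(fixed points on the representative line) = 12 / 13 / 12`. -/
theorem flagMatR_rowSum (r : FRow ρ) : ∑ c₀ : FCol ρ, σ.flagMatR hl hc hcl hP hL h12 hq hf r c₀ = FlagOrbit.rowSum r := by
  set a := σ.lineRepR hl hc hcl hP hL h12 hq hf r with ha
  have hsum : ∑ c₀ : FCol ρ, σ.flagMatR hl hc hcl hP hL h12 hq hf r c₀ = ∑ S ∈ σ.orbits3, (S.filter fun q => q ∈ a).card :=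
    σ.sum_colOrbitR hl hc hcl hP hL h12 hq hf (fun S => (S.filter fun q => q ∈ a).card)
  have hsplit := σ.card_points_on_line_split a
  rw [h12, ← σ.sum_orbits3_card_filter hq a, ← hsum] at hsplit
  obtain ⟨hΓ, hside, hT⟩ := σ.lineRepR_fixed_facts hl hc hcl hP hL h12 hq hf
  -- the number of fixed points on `a`, by row type
  rcases r with s | x | ⟨k, t⟩
  · have hF : (univ.filter fun q : P => q ∈ a ∧ σ.onPoints q = q) = {c} := by
      ext q; rw [mem_filter, mem_singleton]
      exact ⟨fun h => (hΓ s).2 q h.2.2 h.2.1, fun h => by rw [h]; exact ⟨mem_univ _, (hΓ s).1, hc⟩⟩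
    rw [hF, card_singleton] at hsplit
    simp only [FlagOrbit.rowSum]; omega
  · have hF : (univ.filter fun q : P => q ∈ a ∧ σ.onPoints q = q) = ∅ := by
      rw [filter_eq_empty_iff]; intro q _ h; exact hside x q h.2 h.1
    rw [hF, card_empty] at hsplit
    simp only [FlagOrbit.rowSum]; omega
  · have hF : (univ.filter fun q : P => q ∈ a ∧ σ.onPoints q = q) = {(σ.eFixPR hc hf k).1} := by
      ext q; rw [mem_filter, mem_singleton]
      exact ⟨fun h => (hT k t).2.2 q h.2.2 h.2.1, fun h => by rw [h]; exact ⟨mem_univ _, (hT k t).1, (σ.eFixPR hc hf k).2.1⟩⟩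
    rw [hF, card_singleton] at hsplit
    simp only [FlagOrbit.rowSum]; omega

/-- **Conjunct 2 — column totals:** `Σ_r flagMatR r c = 13 − #(fixed lines through the representative point) = 12 / 13 / 12`. -/
theorem flagMatR_colSum (c₀ : FCol ρ) : ∑ r : FRow ρ, σ.flagMatR hl hc hcl hP hL h12 hq hf r c₀ = FlagOrbit.colSum c₀ := by
  set p := σ.pointRepR hl hc hcl hP hL h12 hq hf c₀ with hp
  have hsum : ∑ r : FRow ρ, σ.flagMatR hl hc hcl hP hL h12 hq hf r c₀ = ∑ B ∈ σ.lineOrbits3, (B.filter fun m => p ∈ m).card := by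
    rw [← σ.sum_rowOrbitR hl hc hcl hP hL h12 hq hf (fun B => (B.filter fun m => p ∈ m).card)]
    exact Finset.sum_congr rfl fun r _ => σ.flagMatR_eq_card_lines hl hc hcl hP hL h12 hq hf r c₀
  have hsplit := σ.card_lines_through_split p
  rw [h12, ← σ.sum_lineOrbits3_card_filter hq p, ← hsum] at hsplit
  obtain ⟨hZ, htri, hT⟩ := σ.pointRepR_facts hl hc hcl hP hL h12 hq hf
  rcases c₀ with t | ⟨s, i⟩ | ⟨j, t⟩
  · have hF : (univ.filter fun m : L => p ∈ m ∧ σ.onLines m = m) = {l} := by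
      ext m; rw [mem_filter, mem_singleton]
      exact ⟨fun h => (hZ t).2 m h.2.2 h.2.1, fun h => by rw [h]; exact ⟨mem_univ _, (hZ t).1, hl⟩⟩
    rw [hF, card_singleton] at hsplit
    simp only [FlagOrbit.colSum]; omega
  · have hF : (univ.filter fun m : L => p ∈ m ∧ σ.onLines m = m) = ∅ := by
      rw [filter_eq_empty_iff]; intro m _ h; exact htri s i m h.2 h.1
    rw [hF, card_empty] at hsplit
    simp only [FlagOrbit.colSum]; omega
  · have hF : (univ.filter fun m : L => p ∈ m ∧ σ.onLines m = m) = {(σ.eFixLR hl hc hf j).1} := by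
      ext m; rw [mem_filter, mem_singleton]
      exact ⟨fun h => (hT j t).2 m h.2.2 h.2.1, fun h => by rw [h]; exact ⟨mem_univ _, (hT j t).1, (σ.eFixLR hl hc hf j).2.1⟩⟩
    rw [hF, card_singleton] at hsplit
    simp only [FlagOrbit.colSum]; omega

/-- **Conjunct 5 — the c-line rows** (`FlagOrbitCols.card_colOrbitR_filter_repF`). -/
theorem flagMatR_gamma (s : Fin ρ) (c₀ : FCol ρ) : σ.flagMatR hl hc hcl hP hL h12 hq hf (Sum.inl s) c₀ = FlagOrbit.gammaEntry s c₀ :=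
  σ.card_colOrbitR_filter_repF hl hc hcl hP hL h12 hq hf s c₀

/-- **Conjunct 6 — a T-line row vanishes on the `Z`-columns:** the T-line meets `l` in the fixed point `y_k`, which lies in no orbit of a
non-fixed point of `l`. -/
theorem flagMatR_tline_z (kt : Fin (12 - 3 * ρ) × Fin 4) (t : Fin ρ) :
    σ.flagMatR hl hc hcl hP hL h12 hq hf (Sum.inr (Sum.inr kt)) (Sum.inl t) = 0 := by
  obtain ⟨k, t'⟩ := kt
  obtain ⟨z, hz, hzeq⟩ := mem_image.1 (σ.eZR hl hP h12 hq hf t).2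
  rw [mem_filter] at hz
  set y := σ.eFixPR hc hf k with hy
  obtain ⟨hyb, hbl, -⟩ := σ.lineRepR_tline_spec hl hc hcl hP hL h12 hq hf k t'
  set b := σ.lineRepR hl hc hcl hP hL h12 hq hf (Sum.inr (Sum.inr (k, t'))) with hb
  have hmeet : meetPt c b l = y.1 := (meetPt_eq c hbl hyb (hP y.1 y.2.1)).symm
  change (((σ.eZR hl hP h12 hq hf t).1 : Finset P).filter fun q => q ∈ b).card = 0
  rw [← hzeq, σ.card_filter_orb3_on_fixedLine (c := c) hl hbl hz.2.1, hmeet, if_neg (σ.not_mem_orb3_of_fixed y.2.1 hz.2.2)]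

/-- **Conjunct 7 — the side diagonal:** the side of `x` meets the triangle of `x` in exactly the two vertices `x, σx`. -/
theorem flagMatR_side_diag (x : Fin ρ × Fin 12) :
    σ.flagMatR hl hc hcl hP hL h12 hq hf (Sum.inr (Sum.inl x)) (Sum.inr (Sum.inl x)) = 2 := by
  obtain ⟨s, i⟩ := x
  set v := σ.eTriR hc hL h12 hq hf s i with hv
  obtain ⟨hva, hσva, hna, -⟩ := σ.lineRepR_side_spec hl hc hP hL h12 hq hf s i
  have hvf : σ.onPoints v.1 ≠ v.1 := σ.not_fixed_of_exterior_flag hl hP (σ.exterior_of_triIdxR hc hL h12 hq hf s v)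
  change ((orb3 σ.onPoints v.1).filter fun q => q ∈ σ.sideOf l v.1).card = 2
  rw [σ.filter_orb3_eq_pair_of_side hvf hna hva hσva, card_pair (fun e => hvf e.symm)]

end Data

end Flag

end Collineation

end Summit.Ventures.DiscreteObjects.PP12
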